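import Summits.AtomisticToContinuum.BoseEinsteinCondensation.Theorems.BECCutLineWeakDisorderWitnessTransferCoreEntry
import Literature.MathematicalPhysics.QuantumManyBody.GroundStateFeynmanKacMarkov
import Literature.MathematicalPhysics.QuantumManyBody.GroundStateFeynmanKacGaussian
import Mathlib.Probability.BrownianMotion.Basic
import Mathlib.Probability.Distributions.Gaussian.IsGaussianProcess.Independence
import Mathlib.Probability.Distributions.Gaussian.HasGaussianLaw.Independence
import HarnessLib

/-!
# Route BECCutLineWeakDisorder — `WitnessTransfer`, (S1): the radial and the transverse part of
# the pair Brownian motion are independent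

Support file (does not close the item) for item stmt-AtomisticToContinuum-14978
(`Summit.AtomisticToContinuum.BoseEinsteinCondensation.Theses.BECCutLineWeakDisorder`, decl
`WitnessTransfer`), stub (S1) `stub_indepFun_pairRadial_pairTransverse` of line `Sketch`.

Under `wienerPaths N` the Feynman–Kac sample space carries `3N` independent Brownian coordinates
`b_s(ω a l)`. For two particles `i ≠ j` let `d^l_s = b_s(ω i l) - b_s(ω j l)` be the pair
difference and, for a unit vector `e ∈ ℝ³`, `U'_s = ∑_l e_l d^l_s` its radial component and
`V'^{(k,t)} = d^k_t - U'_t e_k` its transverse part. We prove: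

* `isGaussianProcess_pathCoordAll` — the master process `((a, l), t) ↦ b_t(ω a l)` on
  `(Fin N × Fin 3) × ℝ≥0` is Gaussian (independent Gaussian coordinate processes are jointly
  Gaussian, Mathlib `iIndepFun.hasGaussianLaw`);
* `isGaussianProcess_sumElim_pairRadial_pairTransverse` — `(U', V')` on `ℝ≥0 ⊕ (Fin 3 × ℝ≥0)`
  is Gaussian (linear functionals of finitely many coordinates);
* `covariance_pathCoord`, `covariance_pairDiff`, `covariance_pairRadial_pairDiff`,
  `covariance_pairRadial_pairRadial`, `covariance_pairRadial_pairTransverse` — the covariances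
  `Cov(d^l_s, d^{l'}_t) = 2 δ_{ll'} (s ∧ t)`, `Cov(U'_s, d^k_t) = 2 e_k (s ∧ t)`,
  `Cov(U'_s, U'_t) = 2|e|² (s ∧ t)`, hence `Cov(U'_s, V'^{(k,t)}) = 0` for `|e| = 1`;
* `stub_indepFun_pairRadial_pairTransverse` — **`U'` and `V'` are independent** (Mathlib
  `IsGaussianProcess.indepFun_of_covariance_eq_zero`).

## References

* D. Revuz, M. Yor, *Continuous Martingales and Brownian Motion* (1999), Ch. I Ex. (1.11)
  (orthogonal transformations of Brownian motion). [RevuzYor1999]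
* K. L. Chung, Z. Zhao, *From Brownian Motion to Schrödinger's Equation* (1995), §3.3.
  [ChungZhao1995]
-/

noncomputable section

open MeasureTheory ProbabilityTheory Filter Set Metric
open scoped ENNReal NNReal Topology

namespace Summit.AtomisticToContinuum.BoseEinsteinCondensation.Theorems.CutLineWitness

open Literature.MathematicalPhysics.QuantumManyBody.BoseGas
open Literature.Probability.Process

/-- Evaluations of a Brownian coordinate are square integrable. [folklore] -/
theorem memLp_two_pathCoord {N : ℕ} (a : Fin N) (l : Fin 3) (s : ℝ≥0) :
    MemLp (fun ω : PathSpace N => brownian s (ω a l)) 2 (wienerPaths N) :=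
  ((isPreBrownianReal_pathCoord a l).isGaussianProcess.hasGaussianLaw_eval s).memLp_two

/-- Covariances of the Brownian coordinates:
`Cov(b_s(ω a l), b_t(ω b l')) = δ_{(a,l),(b,l')} (s ∧ t)` (one pre-Brownian motion, resp. two
independent coordinates). [folklore] -/
theorem covariance_pathCoord {N : ℕ} (a : Fin N) (l : Fin 3) (b : Fin N) (l' : Fin 3)
    (s t : ℝ≥0) :
    cov[fun ω : PathSpace N => brownian s (ω a l), fun ω : PathSpace N => brownian t (ω b l');
      wienerPaths N] = if a = b ∧ l = l' then min (s : ℝ) t else 0 := by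
  split_ifs with h
  · obtain ⟨rfl, rfl⟩ := h
    rw [(isPreBrownianReal_pathCoord a l).covariance_fun_eval, NNReal.coe_min]
  · have hpq : ((a, l) : Fin N × Fin 3) ≠ (b, l') := fun hh =>
      h ⟨congrArg Prod.fst hh, congrArg Prod.snd hh⟩
    have hind : IndepFun (fun ω : PathSpace N => brownian s (ω a l))
        (fun ω : PathSpace N => brownian t (ω b l')) (wienerPaths N) :=
      (iIndepFun_pathCoord.indepFun hpq).comp (measurable_brownian s) (measurable_brownian t)
    exact hind.covariance_eq_zero (memLp_two_pathCoord a l s) (memLp_two_pathCoord b l' t)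

/-- Covariances of the coordinates of the pair difference `d^l_s = b_s(ω i l) - b_s(ω j l)`
(`i ≠ j`): `Cov(d^l_s, d^{l'}_t) = 2 δ_{l l'} (s ∧ t)`. [folklore] -/
theorem covariance_pairDiff {N : ℕ} {i j : Fin N} (hij : i ≠ j) (l l' : Fin 3) (s t : ℝ≥0) :
    cov[fun ω : PathSpace N => brownian s (ω i l) - brownian s (ω j l),
      fun ω : PathSpace N => brownian t (ω i l') - brownian t (ω j l'); wienerPaths N] =
      if l = l' then 2 * min (s : ℝ) t else 0 := by
  rw [covariance_fun_sub_fun_sub (memLp_two_pathCoord i l s) (memLp_two_pathCoord j l s)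
    (memLp_two_pathCoord i l' t) (memLp_two_pathCoord j l' t), covariance_pathCoord,
    covariance_pathCoord, covariance_pathCoord, covariance_pathCoord]
  simp only [hij, hij.symm, false_and, if_false, true_and]
  split_ifs <;> ring

/-- **The `3N` Brownian coordinates are jointly Gaussian**: the master process
`((p, t), ω) ↦ b_t(ω_p)` on `(Fin N × Fin 3) × ℝ≥0` is a Gaussian process under `wienerPaths N`
(independent Gaussian coordinate processes are jointly Gaussian, Mathlib
`iIndepFun.hasGaussianLaw`; on a finite index set `I` the marginal is a coordinate projection of
the family of marginals of the coordinates on the time set `I.image Prod.snd`). [folklore] -/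
theorem isGaussianProcess_pathCoordAll {N : ℕ} :
    IsGaussianProcess
      (fun (q : (Fin N × Fin 3) × ℝ≥0) (ω : PathSpace N) => brownian q.2 (ω q.1.1 q.1.2))
      (wienerPaths N) := by
  classical
  refine ⟨fun I => ?_⟩
  set J : Finset ℝ≥0 := I.image Prod.snd
  have hYg : ∀ p : Fin N × Fin 3, HasGaussianLaw
      (fun ω : PathSpace N => J.restrict fun t => brownian t (ω p.1 p.2)) (wienerPaths N) :=
    fun p => (isPreBrownianReal_pathCoord p.1 p.2).isGaussianProcess.hasGaussianLaw J
  have hind : iIndepFun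
      (fun (p : Fin N × Fin 3) (ω : PathSpace N) => J.restrict fun t => brownian t (ω p.1 p.2))
      (wienerPaths N) :=
    iIndepFun_pathCoord.comp (fun _ (η : ℝ≥0 → ℝ) => J.restrict fun t => brownian t η)
      fun _ => (Finset.measurable_restrict J).comp (measurable_pi_lambda _ measurable_brownian)
  have hjoint : HasGaussianLaw
      (fun (ω : PathSpace N) (p : Fin N × Fin 3) => J.restrict fun t => brownian t (ω p.1 p.2))
      (wienerPaths N) := hind.hasGaussianLaw hYg
  let L : (Fin N × Fin 3 → J → ℝ) →L[ℝ] (I → ℝ) :=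
    { toFun := fun x q => x q.1.1 ⟨q.1.2, Finset.mem_image_of_mem Prod.snd q.2⟩
      map_add' := fun _ _ => rfl
      map_smul' := fun _ _ => rfl }
  exact hjoint.map L

/-- **The radial component `U'_s = ⟨e, d_s⟩` and the transverse part `V'^{(k,t)} = d^k_t - U'_t e_k`
of the pair difference are jointly Gaussian**: each value is a linear functional of finitely many
of the jointly Gaussian Brownian coordinates (Mathlib `IsGaussianProcess.of_isGaussianProcess`).
[folklore] -/
theorem isGaussianProcess_sumElim_pairRadial_pairTransverse {N : ℕ} (i j : Fin N) (e : Space) :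
    IsGaussianProcess
      (Sum.elim
        (fun (s : ℝ≥0) (ω : PathSpace N) => ∑ l, e l * (brownian s (ω i l) - brownian s (ω j l)))
        (fun (p : Fin 3 × ℝ≥0) (ω : PathSpace N) =>
          (brownian p.2 (ω i p.1) - brownian p.2 (ω j p.1)) -
            (∑ l, e l * (brownian p.2 (ω i l) - brownian p.2 (ω j l))) * e p.1))
      (wienerPaths N) := by
  classical
  refine isGaussianProcess_pathCoordAll.of_isGaussianProcess fun x => ?_
  rcases x with s | ⟨k, t⟩
  · refine ⟨Finset.univ ×ˢ {s},
      LinearMap.toContinuousLinearMap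
        { toFun := fun x => ∑ l, e l * (x ⟨((i, l), s), by simp⟩ - x ⟨((j, l), s), by simp⟩)
          map_add' := fun x y => by
            simp only [Pi.add_apply, mul_add, mul_sub, Finset.sum_add_distrib,
              Finset.sum_sub_distrib]
            ring
          map_smul' := fun c x => by
            simp only [Pi.smul_apply, smul_eq_mul, RingHom.id_apply, mul_sub,
              Finset.sum_sub_distrib, mul_left_comm (e _) c, ← Finset.mul_sum] },
        fun ω => ?_⟩
    rfl
  · refine ⟨Finset.univ ×ˢ {t},
      LinearMap.toContinuousLinearMap
        { toFun := fun x => (x ⟨((i, k), t), by simp⟩ - x ⟨((j, k), t), by simp⟩) -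
            (∑ l, e l * (x ⟨((i, l), t), by simp⟩ - x ⟨((j, l), t), by simp⟩)) * e k
          map_add' := fun x y => by
            simp only [Pi.add_apply, mul_add, mul_sub, Finset.sum_add_distrib,
              Finset.sum_sub_distrib]
            ring
          map_smul' := fun c x => by
            simp only [Pi.smul_apply, smul_eq_mul, RingHom.id_apply, mul_sub,
              Finset.sum_sub_distrib, mul_left_comm (e _) c, ← Finset.mul_sum]
            ring }, fun ω => ?_⟩
    rfl

/-- The coordinates of the pair difference are square integrable. [folklore] -/
theorem memLp_two_pairDiff {N : ℕ} (i j : Fin N) (l : Fin 3) (s : ℝ≥0) :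
    MemLp (fun ω : PathSpace N => brownian s (ω i l) - brownian s (ω j l)) 2 (wienerPaths N) :=
  (memLp_two_pathCoord i l s).sub (memLp_two_pathCoord j l s)

/-- The radial component of the pair difference is square integrable. [folklore] -/
theorem memLp_two_pairRadial {N : ℕ} (i j : Fin N) (e : Space) (s : ℝ≥0) :
    MemLp (fun ω : PathSpace N => ∑ l, e l * (brownian s (ω i l) - brownian s (ω j l))) 2
      (wienerPaths N) :=
  memLp_finsetSum _ fun l _ => (memLp_two_pairDiff i j l s).const_mul (e l)

/-- `Cov(⟨e, d_s⟩, d^k_t) = 2 e_k (s ∧ t)` for the pair difference `d` (`i ≠ j`). [folklore] -/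
theorem covariance_pairRadial_pairDiff {N : ℕ} {i j : Fin N} (hij : i ≠ j) (e : Space) (k : Fin 3)
    (s t : ℝ≥0) :
    cov[fun ω : PathSpace N => ∑ l, e l * (brownian s (ω i l) - brownian s (ω j l)),
      fun ω : PathSpace N => brownian t (ω i k) - brownian t (ω j k); wienerPaths N] =
      2 * e k * min (s : ℝ) t := by
  rw [covariance_fun_sum_left (fun l => (memLp_two_pairDiff i j l s).const_mul (e l))
    (memLp_two_pairDiff i j k t)]
  simp_rw [covariance_const_mul_left, covariance_pairDiff hij, mul_ite, mul_zero,
    Finset.sum_ite_eq' Finset.univ k, Finset.mem_univ, if_true]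
  ring

/-- `Cov(⟨e, d_s⟩, ⟨e, d_t⟩) = 2 |e|² (s ∧ t)` for the pair difference `d` (`i ≠ j`). [folklore] -/
theorem covariance_pairRadial_pairRadial {N : ℕ} {i j : Fin N} (hij : i ≠ j) (e : Space)
    (s t : ℝ≥0) :
    cov[fun ω : PathSpace N => ∑ l, e l * (brownian s (ω i l) - brownian s (ω j l)),
      fun ω : PathSpace N => ∑ l, e l * (brownian t (ω i l) - brownian t (ω j l)); wienerPaths N] =
      2 * (∑ l, e l ^ 2) * min (s : ℝ) t := by
  rw [covariance_fun_sum_fun_sum (fun l => (memLp_two_pairDiff i j l s).const_mul (e l))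
    (fun l => (memLp_two_pairDiff i j l t).const_mul (e l))]
  simp_rw [covariance_const_mul_left, covariance_const_mul_right, covariance_pairDiff hij, mul_ite,
    mul_zero, Finset.sum_ite_eq Finset.univ, Finset.mem_univ, if_true, Finset.mul_sum,
    Finset.sum_mul]
  exact Finset.sum_congr rfl fun l _ => by ring

/-- **The cross covariances of the radial component and the transverse part vanish**:
`Cov(U'_s, V'^{(k,t)}) = 2 e_k (s ∧ t) - 2 |e|² (s ∧ t) e_k = 0` for `|e| = 1`. [folklore] -/
theorem covariance_pairRadial_pairTransverse {N : ℕ} {i j : Fin N} (hij : i ≠ j) (e : Space)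
    (he : ‖e‖ = 1) (s : ℝ≥0) (p : Fin 3 × ℝ≥0) :
    cov[fun ω : PathSpace N => ∑ l, e l * (brownian s (ω i l) - brownian s (ω j l)),
      fun ω : PathSpace N => (brownian p.2 (ω i p.1) - brownian p.2 (ω j p.1)) -
        (∑ l, e l * (brownian p.2 (ω i l) - brownian p.2 (ω j l))) * e p.1; wienerPaths N] = 0 := by
  have he2 : ∑ l, e l ^ 2 = 1 := by rw [← EuclideanSpace.real_norm_sq_eq, he, one_pow]
  rw [covariance_fun_sub_right (memLp_two_pairRadial i j e s) (memLp_two_pairDiff i j p.1 p.2)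
    ((memLp_two_pairRadial i j e p.2).mul_const (e p.1)), covariance_mul_const_right,
    covariance_pairRadial_pairDiff hij, covariance_pairRadial_pairRadial hij, he2]
  ring

/-- The radial component is measurable at each time. [folklore] -/
theorem measurable_pairRadial {N : ℕ} (i j : Fin N) (e : Space) (s : ℝ≥0) :
    Measurable fun ω : PathSpace N => ∑ l, e l * (brownian s (ω i l) - brownian s (ω j l)) := by
  fun_prop

/-- The transverse part is measurable at each index. [folklore] -/
theorem measurable_pairTransverse {N : ℕ} (i j : Fin N) (e : Space) (p : Fin 3 × ℝ≥0) :
    Measurable fun ω : PathSpace N => (brownian p.2 (ω i p.1) - brownian p.2 (ω j p.1)) -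
      (∑ l, e l * (brownian p.2 (ω i l) - brownian p.2 (ω j l))) * e p.1 := by
  fun_prop

/-- **(S1)** For `i ≠ j` and a unit vector `e`, the radial component `⟨e, d_s⟩` of the pair
difference `d_s = (b_s(ω i l) − b_s(ω j l))_l` and its transverse part `d_t − ⟨e, d_t⟩ e` are
independent processes under `wienerPaths N` (jointly Gaussian with vanishing cross covariance,
Mathlib `IsGaussianProcess.indepFun_of_covariance_eq_zero`). [folklore] -/
theorem stub_indepFun_pairRadial_pairTransverse {N : ℕ} {i j : Fin N} (hij : i ≠ j) (e : Space)
    (he : ‖e‖ = 1) :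
    IndepFun (fun (ω : PathSpace N) (s : ℝ≥0) => ∑ l, e l * (brownian s (ω i l) - brownian s (ω j l)))
      (fun (ω : PathSpace N) (p : Fin 3 × ℝ≥0) =>
        (brownian p.2 (ω i p.1) - brownian p.2 (ω j p.1)) -
          (∑ l, e l * (brownian p.2 (ω i l) - brownian p.2 (ω j l))) * e p.1)
      (wienerPaths N) :=
  (isGaussianProcess_sumElim_pairRadial_pairTransverse i j e).indepFun_of_covariance_eq_zero
    (fun s => (measurable_pairRadial i j e s).aemeasurable)
    (fun p => (measurable_pairTransverse i j e p).aemeasurable)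
    fun s p => covariance_pairRadial_pairTransverse hij e he s p

end Summit.AtomisticToContinuum.BoseEinsteinCondensation.Theorems.CutLineWitness
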